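import Summits.QuantumFields.YangMills.Theorems.BalabanUVNodesN21ThresholdSelection

/-!
# YM-DAG node N21 (= NE7c) — THE MASS-TRANSPORT READING OF ROW A″'s PUSHES: lineage masses through Markov kernels, the positive-linear tilt
# sandwich uniform in the number of steps, the junction constants `M₁ = C`, `M₂ = C⁻¹`, `hdep` = causality, one multiplier per step, box admissibility
# from relative room (lens Cards 11–13; the ENGINE of ROW A‴ «`BalabanUVNodesN21SelectedThresholdsTransportLedgers`», module 20c)

Track A of `YM-PLAN.md` (cell `pub-ymgap`, HUMAN RULING D-0062), node **N21**; R134 fan-out seat `pub-ymgap-dag-n21-d` (s2), generation 5, module 20b.  THEOREMS ONLY: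
0 `def`, 0 `sorry`, standard axioms; COUNT-NEUTRAL; `--supports` the K3‴ item `SpineGivenEndpointR13` (stmt-QuantumFields-19912) as a helper.  NO Theses import, NO
`Node00.Record13` import.  THIS FILE IS the planner seat `ym-lens-BalabanUVNodes-nearmiss` g5's farm-checked sketch `Sketch-nearmiss-g5.lean` (sha16 e81bed0d73d9d168)
§A ∕ §B ∕ §B′ ∕ §C ∕ §D ∕ §E VERBATIM (namespace renamed; CREDIT: ym-lens-BalabanUVNodes-nearmiss g5, memo `LENS-nearmiss.md` v5.0 598477c14fca0f20, Cards 11–13,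
FAN-OUT ROW A‴ §1), exactly as module 18a `BalabanUVNodesN21ThresholdSelection` was g4's sketch.  Imports module 18a only (as the sketch does).

THE WALL AFTER ROW A″ (modules 18a∕18b∕18c∕19 of this seat's g4, p484430 ∕ p485209 ∕ p485946 ∕ p487856; module 20 p491967 moved the (R) binders and the
piece pushes onto the cell's history-indexed type).  The provable statement is `N21SelectedThresholds.levelLedgers_of_selectedThresholds`; its displayed binders are
`hdep` (the dominating laws `ν K a s` read only OLDER thresholds), `hpushA∕B` (`∑ τ, piece K a t s τ ≤ M₁ · (ν K a s (shell at level lvl s)).toReal` for every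
admissible `a`, `|t| ≤ l₀`), `htotalA∕B` (`M₂ · (ν K a s univ).toReal ≤ ∑ τ, A K a t τ`), `hcard` and the admissibility of the whole box `∏_j [(1 − κ_j)θ_j, θ_j]`.
Module 18b's HONEST FRAMING filed the pushes as "(R) + (PD), lens Card 8 — E-class".

THE LENS g5 DIAGNOSIS (its print audit of [Balaban1989LargeFieldI] §0–§1 pp. 175–202, [Balaban1989LargeFieldII] §1 pp. 377–392, [Balaban1988Convergent] §2–§3;
reached independently by this seat's (K8-i) read of [Balaban1988Convergent] p. 257–258, module 20's header): inside Bałaban's procedure EVERY bookkeeping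
operation acting on the vector of term densities is POSITIVE and LINEAR and preserves total mass — (T) the renormalization transformation is a push-forward;
(D) decompositions of unity split a term exactly; (R) the only density-CHANGING part of the R-operation is an INTEGRATION of a term over local gauge variables
([B15] p. 193 «All the above transformations preserve the kth density … they change only the representation … equivalence means that both sides have equal
integrals», (0.4)), i.e. a Markov kernel; everything else is a change of representation of one nonnegative function; (POS) terms are nonnegative; (NO-DROP)
nothing is discarded.  CONSEQUENCE (this file, [folklore] measure theory): with `ν K a s :=` the run's bookkeeping state law at the START of step `lvl s`
(untilted run), the pushes hold with NO cluster-expansion input —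
* §A the pieces of a slot summed over the final terms are AT MOST (exactly, without deletions) the state-law mass of the slot's shell (sub-Markov lineage
  weights through a Markov kernel: `sum_lineageMass_le`, `sum_lineageMass_eq`, `sum_lineageMass_le_mul`, `mul_stateMass_le_sum_lineageMass`);
* §B the tilt `e^{tO}`, `|tO| ≤ c`, enters only the initial density and every later operation is positive-linear, so the tilted and untilted state laws
  sandwich each other with the SAME constant `C = e^{c}` at every step, uniformly in the number of steps (`sandwich_of_posLinear`, `posLinear_comp`; kernel
  and density steps are positive-linear: `bind_mono_left`, `bind_smul_left`, `withDensity_mono_left`, `withDensity_smul_left`; `withDensity_le_smul`,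
  `le_smul_withDensity`); §B′ the junction to 18b's `toReal` currency: `pushes_of_sandwich` ⇒ `M₁ = C`, `M₂ = C⁻¹`;
* §C `hdep` is CAUSALITY (`hdep_of_restrict`); §D one multiplier per STEP serves every letter family of the step (`slotAntiConcentration_scale`); §E box
  admissibility from RELATIVE ROOM (`box_admissible`).
What stays DISPLAYED is structural, not analytic: NODE O's threshold-parametric term object must come with its LINEAGE structure (kernels + partitions of
unity + merges, (POS), (NO-DROP)) — the (R) facts of road I — and print's finite list of cross-step rooms (lens Card 12's table).

HONEST FRAMING (binding).  [folklore] measure theory; nothing of Bałaban's asserted or instantiated (the audit above is the lens's reading of DISPLAYED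
formulas and prose, not a line-by-line certification); the thresholds are CHOSEN inside admissible windows (road (δ)'s lever) — (M1) for print's FIXED
printed thresholds is untouched; NE7c is NOT PRINTED and NOT PROVED; **N21 is NOT discharged**; typed 28∕28, discharged count untouched; one finite
four-torus programme at fixed `ε` — NOT ℝ⁴, NOT infinite volume, NOT OS, NOT a mass gap, NOT Clay.  No decl below carries a cite tag.
-/

set_option autoImplicit false

noncomputable section

open scoped BigOperators ENNReal
open MeasureTheory ProbabilityTheory Set

namespace Summit.QuantumFields.YangMills.Theorems.N21SelectedThresholdsTransport

open Literature.MathematicalPhysics.QuantumFieldTheory.Balaban1983to89.T4ShellMeasure (SlotAntiConcentration)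

/-! ## §A  MASS TRANSPORT THROUGH THE YOUNGER STEPS

One (composite) younger stage seen from the start of the slot's step: the state law `ν` on `X` (all variables alive
then); the younger variables adjoined by a Markov kernel `κ : Kernel X Y` (composite of the younger T-steps and of the
R-operation's local integrations — a composite of Markov kernels is Markov); the younger decompositions of unity and
merges = finitely many LINEAGES `p ∈ P` with jointly measurable weights `q p x y ≥ 0` summing to `≤ 1` (`= 1` when
nothing is deleted — Bałaban deletes nothing).  The piece of lineage `p` on the event `E` (the slot's shell, an event
in the variables alive at the slot's step) is `∫_E ∫ q p x y κ(x,dy) ν(dx)`. -/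

section MassTransport

variable {X Y : Type*} [MeasurableSpace X] [MeasurableSpace Y]

/-- **PIECES ≤ STATE-LAW MASS OF THE SHELL** (`hpush` with `M₁ = 1` before the tilt): sub-Markov lineage weights pushed
through a Markov kernel lose no mass and create none on any event of the older variables. [folklore] -/
theorem sum_lineageMass_le (ν : Measure X) (κ : Kernel X Y) [IsMarkovKernel κ] {π : Type*} (P : Finset π)
    (q : π → X → Y → ℝ≥0∞) (hq : ∀ p, Measurable (Function.uncurry (q p)))
    (hsub : ∀ x y, ∑ p ∈ P, q p x y ≤ 1) (E : Set X) :
    ∑ p ∈ P, ∫⁻ x in E, ∫⁻ y, q p x y ∂(κ x) ∂ν ≤ ν E := by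
  rw [← lintegral_finsetSum P (fun p _ => Measurable.lintegral_kernel_prod_right (κ := κ) (hq p))]
  calc ∫⁻ x in E, ∑ p ∈ P, ∫⁻ y, q p x y ∂(κ x) ∂ν
      = ∫⁻ x in E, ∫⁻ y, ∑ p ∈ P, q p x y ∂(κ x) ∂ν :=
        lintegral_congr fun x => (lintegral_finsetSum P fun p _ => (hq p).of_uncurry_left).symm
    _ ≤ ∫⁻ x in E, ∫⁻ _y, (1 : ℝ≥0∞) ∂(κ x) ∂ν :=
        lintegral_mono fun x => lintegral_mono fun y => hsub x y
    _ = ν E := by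
        have h1 : ∀ x, ∫⁻ _y, (1 : ℝ≥0∞) ∂(κ x) = 1 := fun x => by rw [lintegral_one, measure_univ]
        simp_rw [h1]
        exact setLIntegral_one E

/-- **EXACT MASS TRANSPORT** (no deletions: the weights sum to `1`): the lineage masses on `E` add up to `ν E`
exactly — the identity behind `htotal` (take `E = univ`: the final term weights sum to the start-of-step total mass,
Bałaban's (0.4)). [folklore] -/
theorem sum_lineageMass_eq (ν : Measure X) (κ : Kernel X Y) [IsMarkovKernel κ] {π : Type*} (P : Finset π)
    (q : π → X → Y → ℝ≥0∞) (hq : ∀ p, Measurable (Function.uncurry (q p)))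
    (hone : ∀ x y, ∑ p ∈ P, q p x y = 1) (E : Set X) :
    ∑ p ∈ P, ∫⁻ x in E, ∫⁻ y, q p x y ∂(κ x) ∂ν = ν E := by
  rw [← lintegral_finsetSum P (fun p _ => Measurable.lintegral_kernel_prod_right (κ := κ) (hq p))]
  calc ∫⁻ x in E, ∑ p ∈ P, ∫⁻ y, q p x y ∂(κ x) ∂ν
      = ∫⁻ x in E, ∫⁻ y, ∑ p ∈ P, q p x y ∂(κ x) ∂ν :=
        lintegral_congr fun x => (lintegral_finsetSum P fun p _ => (hq p).of_uncurry_left).symm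
    _ = ∫⁻ x in E, ∫⁻ _y, (1 : ℝ≥0∞) ∂(κ x) ∂ν :=
        lintegral_congr fun x => lintegral_congr fun y => hone x y
    _ = ν E := by
        have h1 : ∀ x, ∫⁻ _y, (1 : ℝ≥0∞) ∂(κ x) = 1 := fun x => by rw [lintegral_one, measure_univ]
        simp_rw [h1]
        exact setLIntegral_one E

/-- **BOUNDED POSITIVE FACTORS COST EXACTLY THEIR SUP** (`hpush` with `M₁ = R̄`): lineages reweighted by measurable factors
`r p x y ≤ R̄` (a tilt, or any bounded positive multiplier picked up on the way) have pieces summing to at most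
`R̄ · ν E`. [folklore] -/
theorem sum_lineageMass_le_mul (ν : Measure X) (κ : Kernel X Y) [IsMarkovKernel κ] {π : Type*} (P : Finset π)
    (q r : π → X → Y → ℝ≥0∞) (hq : ∀ p, Measurable (Function.uncurry (q p)))
    (hsub : ∀ x y, ∑ p ∈ P, q p x y ≤ 1) {Rbar : ℝ≥0∞} (hR : ∀ p x y, r p x y ≤ Rbar) (E : Set X) :
    ∑ p ∈ P, ∫⁻ x in E, ∫⁻ y, r p x y * q p x y ∂(κ x) ∂ν ≤ Rbar * ν E := by
  calc ∑ p ∈ P, ∫⁻ x in E, ∫⁻ y, r p x y * q p x y ∂(κ x) ∂ν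
      ≤ ∑ p ∈ P, ∫⁻ x in E, ∫⁻ y, Rbar * q p x y ∂(κ x) ∂ν :=
        Finset.sum_le_sum fun p _ => lintegral_mono fun x => lintegral_mono fun y =>
          mul_le_mul_left (hR p x y) _
    _ = Rbar * ∑ p ∈ P, ∫⁻ x in E, ∫⁻ y, q p x y ∂(κ x) ∂ν := by
        rw [Finset.mul_sum]
        refine Finset.sum_congr rfl fun p _ => ?_
        have h1 : ∀ x, ∫⁻ y, Rbar * q p x y ∂(κ x) = Rbar * ∫⁻ y, q p x y ∂(κ x) :=
          fun x => lintegral_const_mul Rbar (hq p).of_uncurry_left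
        simp_rw [h1]
        exact lintegral_const_mul Rbar (Measurable.lintegral_kernel_prod_right (κ := κ) (hq p))
    _ ≤ Rbar * ν E := mul_le_mul_right (sum_lineageMass_le ν κ P q hq hsub E) Rbar

/-- **LOWER TWIN** (`htotal` with `M₂ = R₀`): with no deletions and factors `r p x y ≥ R₀`, the total reweighted mass is
at least `R₀ · ν univ`. [folklore] -/
theorem mul_stateMass_le_sum_lineageMass (ν : Measure X) (κ : Kernel X Y) [IsMarkovKernel κ] {π : Type*}
    (P : Finset π) (q r : π → X → Y → ℝ≥0∞) (hq : ∀ p, Measurable (Function.uncurry (q p)))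
    (hr : ∀ p, Measurable (Function.uncurry (r p))) (hone : ∀ x y, ∑ p ∈ P, q p x y = 1)
    {R₀ : ℝ≥0∞} (hR₀ : ∀ p x y, R₀ ≤ r p x y) :
    R₀ * ν univ ≤ ∑ p ∈ P, ∫⁻ x, ∫⁻ y, r p x y * q p x y ∂(κ x) ∂ν := by
  have hm : ∀ p, Measurable (Function.uncurry fun x y => r p x y * q p x y) := fun p => (hr p).mul (hq p)
  rw [← lintegral_finsetSum P (fun p _ => Measurable.lintegral_kernel_prod_right (κ := κ) (hm p))]
  calc R₀ * ν univ = ∫⁻ x, ∫⁻ _y, R₀ ∂(κ x) ∂ν := by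
        have h1 : ∀ x, ∫⁻ _y, R₀ ∂(κ x) = R₀ := fun x => by rw [lintegral_const, measure_univ, mul_one]
        simp_rw [h1]
        rw [lintegral_const]
    _ = ∫⁻ x, ∫⁻ y, ∑ p ∈ P, R₀ * q p x y ∂(κ x) ∂ν := by
        refine lintegral_congr fun x => lintegral_congr fun y => ?_
        rw [← Finset.mul_sum, hone x y, mul_one]
    _ ≤ ∫⁻ x, ∫⁻ y, ∑ p ∈ P, r p x y * q p x y ∂(κ x) ∂ν :=
        lintegral_mono fun x => lintegral_mono fun y =>
          Finset.sum_le_sum fun p _ => mul_le_mul_left (hR₀ p x y) _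
    _ = ∫⁻ x, ∑ p ∈ P, ∫⁻ y, r p x y * q p x y ∂(κ x) ∂ν :=
        lintegral_congr fun x => lintegral_finsetSum P fun p _ => (hm p).of_uncurry_left

end MassTransport

/-! ## §B  THE TILT: POSITIVE-LINEAR BOOKKEEPING PRESERVES A TWO-SIDED SANDWICH, UNIFORMLY IN THE NUMBER OF STEPS -/

section Tilt

variable {X₀ X₁ : Type*} [MeasurableSpace X₀] [MeasurableSpace X₁]

/-- a density bounded above by `C` multiplies the measure by at most `C`. [folklore] -/
theorem withDensity_le_smul (μ : Measure X₀) {f : X₀ → ℝ≥0∞} {C : ℝ≥0∞} (hf : ∀ x, f x ≤ C) :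
    μ.withDensity f ≤ C • μ := by
  refine Measure.le_iff.2 fun s hs => ?_
  rw [withDensity_apply f hs, Measure.smul_apply, smul_eq_mul]
  calc ∫⁻ x in s, f x ∂μ ≤ ∫⁻ _x in s, C ∂μ := lintegral_mono fun x => hf x
    _ = C * μ s := setLIntegral_const s C

/-- a measurable density with `1 ≤ C · f` loses at most the factor `C`. [folklore] -/
theorem le_smul_withDensity (μ : Measure X₀) {f : X₀ → ℝ≥0∞} (hfm : Measurable f) {C : ℝ≥0∞}
    (hf : ∀ x, 1 ≤ C * f x) : μ ≤ C • μ.withDensity f := by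
  refine Measure.le_iff.2 fun s hs => ?_
  rw [Measure.smul_apply, smul_eq_mul, withDensity_apply f hs]
  calc μ s = ∫⁻ _x in s, 1 ∂μ := (setLIntegral_one s).symm
    _ ≤ ∫⁻ x in s, C * f x ∂μ := lintegral_mono fun x => hf x
    _ = C * ∫⁻ x in s, f x ∂μ := lintegral_const_mul C hfm

/-- KERNEL STEPS ARE POSITIVE-LINEAR (monotone). [folklore] -/
theorem bind_mono_left (κ : Kernel X₀ X₁) {μ₁ μ₂ : Measure X₀} (h : μ₁ ≤ μ₂) :
    μ₁.bind κ ≤ μ₂.bind κ := by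
  refine Measure.le_iff.2 fun s hs => ?_
  rw [Measure.bind_apply hs κ.measurable.aemeasurable, Measure.bind_apply hs κ.measurable.aemeasurable]
  exact lintegral_mono' h le_rfl

/-- KERNEL STEPS ARE POSITIVE-LINEAR (homogeneous). [folklore] -/
theorem bind_smul_left (κ : Kernel X₀ X₁) (c : ℝ≥0∞) (μ : Measure X₀) :
    (c • μ).bind κ = c • μ.bind κ :=
  Measure.bind_smul c μ κ

/-- DENSITY STEPS (decompositions of unity, bounded factors) ARE POSITIVE-LINEAR (monotone). [folklore] -/
theorem withDensity_mono_left (f : X₀ → ℝ≥0∞) {μ₁ μ₂ : Measure X₀} (h : μ₁ ≤ μ₂) :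
    μ₁.withDensity f ≤ μ₂.withDensity f := by
  refine Measure.le_iff.2 fun s hs => ?_
  rw [withDensity_apply f hs, withDensity_apply f hs]
  exact lintegral_mono' (Measure.restrict_mono (fun _ hx => hx) h) le_rfl

/-- DENSITY STEPS ARE POSITIVE-LINEAR (homogeneous). [folklore] -/
theorem withDensity_smul_left (f : X₀ → ℝ≥0∞) (c : ℝ≥0∞) (μ : Measure X₀) :
    (c • μ).withDensity f = c • μ.withDensity f :=
  withDensity_smul_measure c f

/-- **THE SANDWICH SURVIVES ANY POSITIVE-LINEAR BOOKKEEPING MAP WITH THE SAME CONSTANT** — in particular any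
composite of kernel steps, density steps and merges, however many (no dependence on the number of steps): if the
tilted and untilted initial densities satisfy `ρt ≤ C ρ₀`, `ρ₀ ≤ C ρt`, so do their images. [folklore] -/
theorem sandwich_of_posLinear (Φ : Measure X₀ → Measure X₁) (hmono : ∀ ⦃μ₁ μ₂ : Measure X₀⦄, μ₁ ≤ μ₂ → Φ μ₁ ≤ Φ μ₂)
    (hsmul : ∀ (c : ℝ≥0∞) (μ : Measure X₀), Φ (c • μ) = c • Φ μ) {ρ₀ ρt : Measure X₀} {C : ℝ≥0∞}
    (h₁ : ρt ≤ C • ρ₀) (h₂ : ρ₀ ≤ C • ρt) : Φ ρt ≤ C • Φ ρ₀ ∧ Φ ρ₀ ≤ C • Φ ρt :=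
  ⟨(hmono h₁).trans_eq (hsmul C ρ₀), (hmono h₂).trans_eq (hsmul C ρt)⟩

/-- positive-linear maps compose (so §B applies to the whole chain of steps `0 … lvl s − 1` at once). [folklore] -/
theorem posLinear_comp {X₂ : Type*} [MeasurableSpace X₂] (Φ : Measure X₀ → Measure X₁) (Ψ : Measure X₁ → Measure X₂)
    (hΦm : ∀ ⦃μ₁ μ₂ : Measure X₀⦄, μ₁ ≤ μ₂ → Φ μ₁ ≤ Φ μ₂) (hΦs : ∀ (c : ℝ≥0∞) (μ : Measure X₀), Φ (c • μ) = c • Φ μ)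
    (hΨm : ∀ ⦃μ₁ μ₂ : Measure X₁⦄, μ₁ ≤ μ₂ → Ψ μ₁ ≤ Ψ μ₂) (hΨs : ∀ (c : ℝ≥0∞) (μ : Measure X₁), Ψ (c • μ) = c • Ψ μ) :
    (∀ ⦃μ₁ μ₂ : Measure X₀⦄, μ₁ ≤ μ₂ → Ψ (Φ μ₁) ≤ Ψ (Φ μ₂)) ∧
      ∀ (c : ℝ≥0∞) (μ : Measure X₀), Ψ (Φ (c • μ)) = c • Ψ (Φ μ) :=
  ⟨fun _ _ h => hΨm (hΦm h), fun c μ => by rw [hΦs, hΨs]⟩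

end Tilt

/-! ## §B′  THE JUNCTION TO MODULE 18b's CURRENCY: `M₁ = C`, `M₂ = C⁻¹` -/

section Junction

variable {X ι : Type*} [MeasurableSpace X]

/-- `toReal` transport of an `ℝ≥0∞` push inequality (the shape of 18b's `hpushA`). [folklore] -/
theorem toReal_sum_le_of_sum_le (T : Finset ι) (m : ι → ℝ≥0∞) {R b : ℝ≥0∞} (hR : R ≠ ∞) (hb : b ≠ ∞)
    (h : ∑ τ ∈ T, m τ ≤ R * b) : ∑ τ ∈ T, (m τ).toReal ≤ R.toReal * b.toReal := by
  have hfin : ∀ τ ∈ T, m τ ≠ ∞ := fun τ hτ =>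
    ne_top_of_le_ne_top (ENNReal.mul_ne_top hR hb) ((Finset.single_le_sum (fun _ _ => zero_le) hτ).trans h)
  rw [← ENNReal.toReal_sum hfin, ← ENNReal.toReal_mul]
  exact ENNReal.toReal_mono (ENNReal.mul_ne_top hR hb) h

/-- `toReal` transport of an `ℝ≥0∞` total-mass inequality (the shape of 18b's `htotalA`). [folklore] -/
theorem toReal_mul_le_sum_of_mul_le (T : Finset ι) (m : ι → ℝ≥0∞) {R b : ℝ≥0∞} (hfin : ∀ τ ∈ T, m τ ≠ ∞)
    (h : R * b ≤ ∑ τ ∈ T, m τ) : R.toReal * b.toReal ≤ ∑ τ ∈ T, (m τ).toReal := by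
  rw [← ENNReal.toReal_sum hfin, ← ENNReal.toReal_mul]
  exact ENNReal.toReal_mono (ENNReal.sum_ne_top.2 hfin) h

/-- **THE TWO PUSHES OF MODULE 18b FROM THE SANDWICH.**  DATA at one (comparison, slot, tilt): the UNTILTED start-of-step
state law `ν₀` (this is 18b's `ν K a s` — `t`-free), the TILTED one `νt`, sandwiched `νt ≤ C ν₀`, `ν₀ ≤ C νt`
(§B, `C = e^{l₀·#loops}`); the final terms' tilted pieces `m τ` of the slot on its shell `E` summing to at most `νt E`
(§A) and tilted weights `A τ` summing to exactly `νt univ` (§A, (0.4)).  CONCLUSION: 18b's `hpush` with `M₁ = C.toReal`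
and `htotal` with `M₂ = C⁻¹.toReal`; hence `M₁∕M₂ = C²`. [folklore] -/
theorem pushes_of_sandwich (T : Finset ι) (ν₀ νt : Measure X) [IsFiniteMeasure ν₀] [IsFiniteMeasure νt]
    {C : ℝ≥0∞} (hC : C ≠ ∞) (hC0 : C ≠ 0) (h₁ : νt ≤ C • ν₀) (h₂ : ν₀ ≤ C • νt)
    (m A : ι → ℝ≥0∞) (E : Set X) (hpiece : ∑ τ ∈ T, m τ ≤ νt E) (htot : ∑ τ ∈ T, A τ = νt univ) :
    (∑ τ ∈ T, (m τ).toReal ≤ C.toReal * (ν₀ E).toReal) ∧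
      (C⁻¹.toReal * (ν₀ univ).toReal ≤ ∑ τ ∈ T, (A τ).toReal) := by
  refine ⟨toReal_sum_le_of_sum_le T m hC (measure_ne_top ν₀ E) (hpiece.trans ?_), ?_⟩
  · have := Measure.le_iff'.1 h₁ E
    rwa [Measure.smul_apply, smul_eq_mul] at this
  · have hfin : ∀ τ ∈ T, A τ ≠ ∞ := fun τ hτ =>
      ne_top_of_le_ne_top (measure_ne_top νt univ)
        ((Finset.single_le_sum (fun _ _ => zero_le) hτ).trans htot.le)
    refine toReal_mul_le_sum_of_mul_le T A hfin ?_
    rw [htot]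
    have h2 : ν₀ univ ≤ C * νt univ := by
      have := Measure.le_iff'.1 h₂ univ
      rwa [Measure.smul_apply, smul_eq_mul] at this
    calc C⁻¹ * ν₀ univ ≤ C⁻¹ * (C * νt univ) := mul_le_mul_right h2 _
      _ = νt univ := by rw [← mul_assoc, ENNReal.inv_mul_cancel hC0 hC, one_mul]

end Junction

/-! ## §C  `hdep` IS CAUSALITY -/

/-- If the dominating law of a slot is, BY CONSTRUCTION, a function of the thresholds of the levels strictly below its
own (a start-of-step state law only involves operations of older steps), then 18b's `hdep` holds. [folklore] -/
theorem hdep_of_restrict {σ : Type*} {X : ℕ → σ → Type*} [∀ K s, MeasurableSpace (X K s)] (lvl : ℕ → σ → ℕ)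
    (F : ∀ (K : ℕ) (s : σ), (Fin (lvl K s) → ℝ) → Measure (X K s)) :
    ∀ (K : ℕ) (s : σ) (a b : ℕ → ℝ), (∀ i, i < lvl K s → a i = b i) →
      F K s (fun i : Fin (lvl K s) => a (i : ℕ)) = F K s (fun i : Fin (lvl K s) => b (i : ℕ)) := by
  intro K s a b hab
  have : (fun i : Fin (lvl K s) => a (i : ℕ)) = fun i : Fin (lvl K s) => b (i : ℕ) :=
    funext fun i => hab (i : ℕ) i.isLt
  rw [this]

/-! ## §D  ONE MULTIPLIER PER STEP SERVES EVERY LETTER FAMILY OF THE STEP -/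

/-- `SlotAntiConcentration` is invariant under a common positive rescaling of statistic and threshold: a slot whose
printed letter is `c · θ_j` (bond, fluctuation, `δ′_j`, an R-ladder rung `(1 − β(1 − 2^{-(n+1)}))ε_h`, …) is read in
units of the step's nominal `θ_j` and shares the step's multiplier. [folklore] -/
theorem slotAntiConcentration_scale {Ω : Type*} [MeasurableSpace Ω] {μ : Measure Ω} {u : Ω → ℝ} {θ ρ D c : ℝ}
    (hc : 0 < c) (h : SlotAntiConcentration μ u θ ρ D) :
    SlotAntiConcentration μ (fun x => c * u x) (c * θ) ρ D := by
  unfold SlotAntiConcentration at h ⊢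
  have hset : {x | c * θ * (1 - ρ) ≤ c * u x ∧ c * u x < c * θ} = {x | θ * (1 - ρ) ≤ u x ∧ u x < θ} := by
    ext x
    simp only [Set.mem_setOf_eq]
    constructor
    · rintro ⟨h1, h2⟩
      exact ⟨le_of_mul_le_mul_left (by rw [← mul_assoc]; exact h1) hc, lt_of_mul_lt_mul_left h2 hc.le⟩
    · rintro ⟨h1, h2⟩
      exact ⟨by rw [mul_assoc]; exact mul_le_mul_of_nonneg_left h1 hc.le, mul_lt_mul_of_pos_left h2 hc⟩
  rw [hset]
  exact h

/-! ## §E  BOX ADMISSIBILITY FROM RELATIVE ROOM -/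

/-- A printed cross-step implication "letter₁-condition ⇒ letter₂-condition" that print verifies at the NOMINAL letters
with relative room `r` (`c·θ₁ ≤ (1 − r)·θ₂`) holds for EVERY pair of thresholds of the box `x₁ ≤ θ₁`, `(1 − κ)θ₂ ≤ x₂`
as soon as `κ ≤ r`.  (Same-step nestings need no room at all: their letters share the step's multiplier, §D.) [folklore] -/
theorem box_admissible {c θ₁ θ₂ r κ x₁ x₂ : ℝ} (hc : 0 ≤ c) (hθ₂ : 0 ≤ θ₂) (hroom : c * θ₁ ≤ (1 - r) * θ₂)
    (hκr : κ ≤ r) (hx₁ : x₁ ≤ θ₁) (hx₂ : (1 - κ) * θ₂ ≤ x₂) : c * x₁ ≤ x₂ :=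
  calc c * x₁ ≤ c * θ₁ := mul_le_mul_of_nonneg_left hx₁ hc
    _ ≤ (1 - r) * θ₂ := hroom
    _ ≤ (1 - κ) * θ₂ := mul_le_mul_of_nonneg_right (by linarith) hθ₂
    _ ≤ x₂ := hx₂

end Summit.QuantumFields.YangMills.Theorems.N21SelectedThresholdsTransport

end
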